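import Summits.MatrixMultiplication.OmegaCensus.SmallFormats.MatMul22nRankGF5XCapMethodLimit
import HarnessLib

/-!
# ω-census family (a): the X-cap counting instrument over `𝔽₅` is exhausted at every slack `s ≥ 20` (and at `5,6,10,11,12,15,16,17,18`)

Cell `pub-omega` (unit `pub-omega-tensor-g9`), topic `Summits/MatrixMultiplication/OmegaCensus` (sub-folder `SmallFormats`).
Framing (verbatim): lottery ticket; floor = certified bounds/negative ranges. HONEST FRAMING: no rank bound anywhere in this
file; it is census bookkeeping that tells the planners which cells the X-marginal counting relaxation `xcapSys5s s`
(`MatMul22nRankGF5XCapSlack`; kernel cells `3n+3` for `n ≥ 17` at `s = 2`, `3n+4` for `n ≥ 27` at `s = 3`) can still produce.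

ADDITIVITY. The rows of `xcapSys5s s` have slack-independent coefficients (`xcapSys5s_A`) and right-hand sides `s·(1,2,0)`
(`rhs5s`), so feasible points add: `Feasible x` at slack `s` and `Feasible y` at slack `t` give `Feasible (x + y)` at slack
`s + t` (`feasible_xcapSys5s_add`). With the two points of `MatMul22nRankGF5XCapMethodLimit` (slack `5`, total `140`;
slack `6`, total `168`) and the uniform point at slack `15` (`2` on every invertible class, `5` on every rank-one class, total
`420`; `xcapWit5s15`) this gives, for every `s = 5a + 6b + 15c`, a feasible point of `xcapSys5s s` in the box `[0,s]` with
total `28·s` = the LP value, hence (`BoxCert.Cert.sum_lt_of_check_root`) **no `BoxCert` certificate for `xcapSys5s s` passes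
at any target `T ≤ 28·s`** (`xcapSys5s_check_false_of_repr`). Every `s ≥ 20` and `s ∈ {5,6,10,11,12,15,16,17,18}` is of
that form (`xcapSys5s_check_false_of_twenty_le`, `xcapSys5s_check_false_of_mem`). Since excluding `3n + s` products needs a
certificate at target `3n + s + 1 ≤ 28s + 1` exactly when `n ≤ 9s`, and `9·R ≥ 28·n` (`MatMul22nRankFiniteField`) already
gives `R ≥ 3n + s + 1` for `n ≥ 9s + 1`, the instrument yields nothing beyond the LP theorem at these slacks. What remains
possible over `𝔽₅`: slacks `4, 7, 8, 9, 13, 14, 19` only (cell note `pub-omega-tensor-g9/METHOD-LIMIT.md`).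
Nothing here is progress on `ω`.
-/

namespace Summit.MatrixMultiplication.OmegaCensus.SmallFormats

open Finset

/-! ## Additivity of feasible points -/

/-- The right-hand sides are additive in the slack. -/
theorem rhs5s_add (s t r : ℕ) : rhs5s (s + t) r = rhs5s s r + rhs5s t r := by
  unfold rhs5s; push_cast; split_ifs <;> ring

/-- **Feasible points add.** -/
theorem feasible_xcapSys5s_add {s t : ℕ} {x y : ℕ → ℕ} (hx : (xcapSys5s s).Feasible x) (hy : (xcapSys5s t).Feasible y) :
    (xcapSys5s (s + t)).Feasible (fun j => x j + y j) := by
  intro r hr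
  have h1 := hx r hr
  have h2 := hy r hr
  change ∑ j ∈ range 157, (xcapSys5s s).A r j * (x j : ℤ) ≤ rhs5s s r at h1
  change ∑ j ∈ range 157, (xcapSys5s t).A r j * (y j : ℤ) ≤ rhs5s t r at h2
  change ∑ j ∈ range 157, (xcapSys5s (s + t)).A r j * ((x j + y j : ℕ) : ℤ) ≤ rhs5s (s + t) r
  simp only [xcapSys5s_A] at h1 h2 ⊢
  rw [rhs5s_add]
  have e : ∑ j ∈ range 157, xcapSys5.A r j * ((x j + y j : ℕ) : ℤ)
      = ∑ j ∈ range 157, xcapSys5.A r j * (x j : ℤ) + ∑ j ∈ range 157, xcapSys5.A r j * (y j : ℤ) := by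
    rw [← sum_add_distrib]
    refine sum_congr rfl fun j _ => ?_
    push_cast; ring
  rw [e]
  exact add_le_add h1 h2

/-- The zero point is feasible at slack `0`. -/
theorem feasible_xcapSys5s_zero : (xcapSys5s 0).Feasible (fun _ => 0) := by
  intro r hr
  change ∑ j ∈ range 157, (xcapSys5s 0).A r j * ((0 : ℕ) : ℤ) ≤ rhs5s 0 r
  simp only [Nat.cast_zero, mul_zero, sum_const_zero]
  unfold rhs5s; split_ifs <;> simp

/-- Multiples of a feasible point are feasible at the multiplied slack. -/
theorem feasible_xcapSys5s_nsmul {s : ℕ} {x : ℕ → ℕ} (hx : (xcapSys5s s).Feasible x) (n : ℕ) :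
    (xcapSys5s (n * s)).Feasible (fun j => n * x j) := by
  induction n with
  | zero => simpa using feasible_xcapSys5s_zero
  | succ n ih =>
    have h := feasible_xcapSys5s_add ih hx
    have e1 : n * s + s = (n + 1) * s := by ring
    rw [e1] at h
    convert h using 2 with j
    ring

/-! ## The uniform slack-`15` point (`2` on invertible classes, `5` on rank-one classes; total `420 = 28·15`) -/

/-- The slack-`15` point as a list in the tree's class index `xvar5` (entry `156` = zero forms = `0`); WLOG-normalised
(`x_I = x 32` is the maximum over invertible classes, `x 33 = x_diag(1,2)` the maximum over its conjugates). -/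
def xcapWit5s15L : List ℕ := [5, 5, 5, 5, 5, 5, 5, 5, 5, 5, 5, 2, 2, 2, 2, 2, 2, 2, 2, 2, 2, 2, 2, 2, 2, 2, 2, 2, 2, 2, 2, 5, 2, 2, 2, 2, 5, 2, 2, 2, 2, 5, 2, 2, 2, 2, 5, 2, 2, 2, 2, 5, 2, 2, 2, 2, 5, 2, 2, 2, 2, 2, 5, 2, 2, 2, 2, 2, 5, 2, 2, 2, 2, 2, 5, 2, 2, 2, 2, 2, 5, 5, 2, 2, 2, 2, 2, 2, 5, 2, 2, 2, 2, 2, 2, 5, 2, 5, 2, 2, 2, 2, 2, 2, 5, 2, 5, 2, 2, 2, 2, 2, 2, 2, 5, 2, 2, 5, 2, 2, 2, 2, 2, 2, 2, 5, 2, 2, 5, 2, 2, 5, 2, 2, 2, 2, 2, 2, 2, 2, 5, 2, 2, 2, 5, 2, 2, 2, 5, 2, 2, 2, 5, 2, 2, 2, 0]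

/-- The slack-`15` point as a function (`0` beyond index `156`). -/
def xcapWit5s15 (j : ℕ) : ℕ := xcapWit5s15L.getD j 0

/-- Box: every entry is `≤ 15`. -/
theorem xcapWit5s15_le : ∀ j, xcapWit5s15 j ≤ 15 := by
  intro j
  by_cases hj : j < 157
  · have h : ∀ i : Fin 157, xcapWit5s15 i.val ≤ 15 := by decide +kernel
    exact h ⟨j, hj⟩
  · have hl : xcapWit5s15L.length = 157 := by decide +kernel
    simp only [xcapWit5s15, List.getD_eq_getElem?_getD]
    rw [List.getElem?_eq_none (by omega)]
    simp

/-- Total `= 420`. -/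
theorem xcapWit5s15_sum : ∑ j ∈ range 157, xcapWit5s15 j = 420 := by decide +kernel

/-- Cap rows `0 … 69`. -/
theorem xcapWit5s15_cap0 : xcapCapOK5 15 xcapWit5s15 0 70 = true := by decide +kernel

/-- Cap rows `70 … 139`. -/
theorem xcapWit5s15_cap1 : xcapCapOK5 15 xcapWit5s15 70 70 = true := by decide +kernel

/-- Cap rows `140 … 209`. -/
theorem xcapWit5s15_cap2 : xcapCapOK5 15 xcapWit5s15 140 70 = true := by decide +kernel

/-- Cap rows `210 … 279`. -/
theorem xcapWit5s15_cap3 : xcapCapOK5 15 xcapWit5s15 210 70 = true := by decide +kernel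

/-- Cap rows `280 … 349`. -/
theorem xcapWit5s15_cap4 : xcapCapOK5 15 xcapWit5s15 280 70 = true := by decide +kernel

/-- WLOG rows. -/
theorem xcapWit5s15_sym : xcapSymOK5 xcapWit5s15 = true := by decide +kernel

/-- The slack-`15` point is feasible for `xcapSys5s 15`. -/
theorem xcapWit5s15_feasible : (xcapSys5s 15).Feasible xcapWit5s15 := by
  refine feasible_xcapSys5s_of_tests (fun ρ hρ => ?_) (xcapSymOK5_spec xcapWit5s15_sym)
  by_cases h0 : ρ < 70
  · exact xcapCapOK5_spec xcapWit5s15_cap0 ρ (by omega) (by omega)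
  by_cases h1 : ρ < 140
  · exact xcapCapOK5_spec xcapWit5s15_cap1 ρ (by omega) (by omega)
  by_cases h2 : ρ < 210
  · exact xcapCapOK5_spec xcapWit5s15_cap2 ρ (by omega) (by omega)
  by_cases h3 : ρ < 280
  · exact xcapCapOK5_spec xcapWit5s15_cap3 ρ (by omega) (by omega)
  exact xcapCapOK5_spec xcapWit5s15_cap4 ρ (by omega) (by omega)

/-- **METHOD LIMIT at slack `15` over `𝔽₅`**: no `BoxCert` certificate for `xcapSys5s 15` (box `[0,15]`) passes at any target
`T ≤ 420 = 28·15` — the counting relaxation cannot exclude `3n + 15` products for any `n ≤ 135`. -/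
theorem xcapSys5s_check_false_fifteen (c : BoxCert.Cert) (D T : ℕ) (hT : T ≤ 420) :
    c.check (xcapSys5s 15) D T 15 [] = false :=
  xcapSys5s_check_false_of_point xcapWit5s15 xcapWit5s15_le xcapWit5s15_feasible
    (by rw [xcapWit5s15_sum]; exact hT) c D

/-! ## Every slack `s = 5a + 6b + 15c` -/

/-- The combined point `a·(slack-5 point) + b·(slack-6 point) + c·(uniform slack-15 point)`. -/
def xcapWit5comb (a b c : ℕ) (j : ℕ) : ℕ := a * xcapWit5s5 j + b * xcapWit5s6 j + c * xcapWit5s15 j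

/-- It is feasible at slack `5a + 6b + 15c`. -/
theorem xcapWit5comb_feasible (a b c : ℕ) : (xcapSys5s (5 * a + 6 * b + 15 * c)).Feasible (xcapWit5comb a b c) := by
  have h5 := feasible_xcapSys5s_nsmul xcapWit5s5_feasible a
  have h6 := feasible_xcapSys5s_nsmul xcapWit5s6_feasible b
  have h15 := feasible_xcapSys5s_nsmul xcapWit5s15_feasible c
  have h := feasible_xcapSys5s_add (feasible_xcapSys5s_add h5 h6) h15
  have e : a * 5 + b * 6 + c * 15 = 5 * a + 6 * b + 15 * c := by ring
  rw [e] at h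
  exact h

/-- It lies in the box `[0, 5a + 6b + 15c]`. -/
theorem xcapWit5comb_le (a b c : ℕ) : ∀ j, xcapWit5comb a b c j ≤ 5 * a + 6 * b + 15 * c := by
  intro j
  have h5 := xcapWit5s5_le j
  have h6 := xcapWit5s6_le j
  have h15 := xcapWit5s15_le j
  unfold xcapWit5comb
  have e1 : a * xcapWit5s5 j ≤ a * 5 := Nat.mul_le_mul_left a h5
  have e2 : b * xcapWit5s6 j ≤ b * 6 := Nat.mul_le_mul_left b h6
  have e3 : c * xcapWit5s15 j ≤ c * 15 := Nat.mul_le_mul_left c h15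
  omega

/-- Its total is the LP value `28·(5a + 6b + 15c)`. -/
theorem xcapWit5comb_sum (a b c : ℕ) : ∑ j ∈ range 157, xcapWit5comb a b c j = 28 * (5 * a + 6 * b + 15 * c) := by
  unfold xcapWit5comb
  rw [sum_add_distrib, sum_add_distrib, ← mul_sum, ← mul_sum, ← mul_sum, xcapWit5s5_sum, xcapWit5s6_sum, xcapWit5s15_sum]
  ring

/-- **METHOD LIMIT at every slack `s = 5a + 6b + 15c`**: no `BoxCert` certificate for `xcapSys5s s` passes at a target `T ≤ 28·s`. -/
theorem xcapSys5s_check_false_of_repr {s : ℕ} (a b c : ℕ) (hs : s = 5 * a + 6 * b + 15 * c)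
    (cert : BoxCert.Cert) (D T : ℕ) (hT : T ≤ 28 * s) : cert.check (xcapSys5s s) D T s [] = false := by
  subst hs
  exact xcapSys5s_check_false_of_point (xcapWit5comb a b c) (xcapWit5comb_le a b c) (xcapWit5comb_feasible a b c)
    (by rw [xcapWit5comb_sum]; exact hT) cert D

/-- **Every slack `s ≥ 20`**: no certificate at `T ≤ 28·s` (every `s ≥ 20` is `5a + 6b`). -/
theorem xcapSys5s_check_false_of_twenty_le {s : ℕ} (hs : 20 ≤ s) (cert : BoxCert.Cert) (D T : ℕ) (hT : T ≤ 28 * s) :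
    cert.check (xcapSys5s s) D T s [] = false :=
  xcapSys5s_check_false_of_repr ((s - 6 * (s % 5)) / 5) (s % 5) 0 (by omega) cert D T hT

/-- **The small exhausted slacks** `5, 6, 10, 11, 12, 15, 16, 17, 18`: no certificate at `T ≤ 28·s`. -/
theorem xcapSys5s_check_false_of_mem {s : ℕ} (hs : s = 5 ∨ s = 6 ∨ s = 10 ∨ s = 11 ∨ s = 12 ∨ s = 15 ∨ s = 16 ∨ s = 17 ∨ s = 18)
    (cert : BoxCert.Cert) (D T : ℕ) (hT : T ≤ 28 * s) : cert.check (xcapSys5s s) D T s [] = false := by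
  rcases hs with h | h | h | h | h | h | h | h | h
  · exact xcapSys5s_check_false_of_repr 1 0 0 (by omega) cert D T hT
  · exact xcapSys5s_check_false_of_repr 0 1 0 (by omega) cert D T hT
  · exact xcapSys5s_check_false_of_repr 2 0 0 (by omega) cert D T hT
  · exact xcapSys5s_check_false_of_repr 1 1 0 (by omega) cert D T hT
  · exact xcapSys5s_check_false_of_repr 0 2 0 (by omega) cert D T hT
  · exact xcapSys5s_check_false_of_repr 3 0 0 (by omega) cert D T hT
  · exact xcapSys5s_check_false_of_repr 2 1 0 (by omega) cert D T hT
  · exact xcapSys5s_check_false_of_repr 1 2 0 (by omega) cert D T hT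
  · exact xcapSys5s_check_false_of_repr 0 3 0 (by omega) cert D T hT

end Summit.MatrixMultiplication.OmegaCensus.SmallFormats
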